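import Summits.Ventures.GridStability.Models.ClassicalSwingLurie
import Summits.Ventures.GridStability.Models.LineAngleTables
import Summits.Ventures.GridStability.Models.WSCC9LosslessLFF
import Literature.MathematicalPhysics.PowerSystems.ClassicalSwingSyncExponentialStability
import HarnessLib

/-!
# LosslessSyncExpStability — the synchronous equilibrium of model-1's LOSSLESS uniform-damping records is LOCALLY EXPONENTIALLY STABLE
# (lit-2's Dörfler–Chertkov–Bullo SI Lemma 1/2 theorem BY NAME on `RecastData.toModelRel λ 0`; instances NE39L and WSCC9L)

Venture GRIDFUSION (LADDER-GRIDFUSION G2.b / G1-cct companions; lit-2 g8 note 21:15:25Z «(S2) SECOND-ORDER lossless classical model SEP —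
`InternalNode.syncEquilibrium_locally_expStable` … needs a LOSSLESS variant of WSCC9/NE39 reduced data»; seat gridfusion-model-1 g8).  model-1 HAS
the lossless variants: `NE39L.data` (p486685, `G := 0`, ★ LFF-P2 / ★ #93 / ★ #121 / ★ #124 object) and `WSCC9.postB_relL` (p485370, `K^G := 0`).
BRIDGE (model-1 g4 `Models/ClassicalSwingLurie.lean` p493501): `ClassicalSwing.toLitNode` (= lit-2's printed `InternalNode`, `H := M`,
`ω_s := 2`; `toLitNode_isEquilibrium_iff`, `isSolutionAt_toLitNode`).  GENERIC (`RecastData.syncEquilibrium_locally_expStable`): for every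
record `d` with NO transfer conductances, reciprocal `B`, positive inertias, positive couplings `C_ij` off the diagonal, exact A1 data
(`EqData θ*`) and an acute equilibrium (`|θ*_i − θ*_j| < π/2`), and every `λ > 0`: the model `d.toModelRel λ 0` (uniform damping
`D_i = λM_i`, exact injections `P′`) has `∃ ρ, k, μ > 0` such that EVERY solution on `ℝ` with `‖(δ(0) − θ*, ω(0))‖_∞ < ρ` satisfies
`‖(δ(t) − (θ* + c·𝟙), ω(t))‖_∞ ≤ k·‖(δ(0) − (θ* + c·𝟙), ω(0))‖_∞·e^{−μt}` for `t ≥ 0`, `c = Σ_j (λM_j(δ_j(0) − θ*_j) + M_jω_j(0)) / Σ_j λM_j`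
— lit-2's `InternalNode.syncEquilibrium_locally_expStable` (p-id in lit-2's register; Lyapunov's indirect method, rotation quotient)
with ALL its hypotheses discharged from the record.  INSTANCES (hypothesis-free): `NE39L.syncEquilibrium_locally_expStable` (every `λ > 0`;
the λ = 1/10 model is M′ of ★ #121/#124) and `WSCC9.postB_relL_syncEquilibrium_locally_expStable`.
THREE COLUMNS.  CERTIFIED: the local exponential stability sentences for the MODELS `NE39L.data.toModelRel λ 0` / `WSCC9.postB_relL.toModelRel λ 0`
(lossless-synthetic variants: MV-2L + MV-RD + MV-λ + MV-h12) — «locally»: `ρ, k, μ` are EXISTENTIAL (no certified basin radius here; the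
certified basins are the LFF / SOS rows).  VALIDATED / MODELLED: nothing new; not a sentence about any printed network or grid.  No definition;
no named fact; standard axioms.  [cite: DorflerChertkovBullo2013, SI §3.1 Lemma 1 (ii), Lemma 2 (2); SauerPai1998, §9.4 eqs. (9.17)–(9.18)]
-/

noncomputable section

open Set Real
open Literature.MathematicalPhysics.PowerSystems

namespace Summit.Ventures.GridStability.Models

namespace RecastData

variable {n : ℕ} (d : RecastData n)

/-- The equilibrium angles of the A1 data are an equilibrium of `toModelRel λ 0` (injections `P′ + M·0`). -/
theorem isEquilibrium_toModelRel_zero (lam : ℚ) {δs : Fin (n + 1) → ℝ} (hE : d.EqData δs) :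
    (d.toModelRel lam 0).IsEquilibrium δs := by
  intro i
  have h := d.isEquilibrium_of_eqData hE i
  simp only [ClassicalSwing.Pe, ClassicalSwing.Ccoef, ClassicalSwing.Dcoef, toModel, toModelRel, mul_zero, add_zero] at h ⊢
  exact h

/-- The coupling graph of a record with positive off-diagonal couplings is connected (cut form; complete graph). -/
theorem couplingConnected_of_pos (lam : ℚ) (hC : ∀ i j, i ≠ j → 0 < d.Cc i j) :
    ClassicalModel.CouplingConnected (d.toModelRel lam 0).toLitNode.C := by
  intro S hS hSc
  obtain ⟨i, hi⟩ := hS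
  obtain ⟨j, hj⟩ := hSc
  have hij : i ≠ j := by
    intro h; subst h; exact (Finset.mem_compl.1 hj) hi
  refine ⟨i, hi, j, hj, ?_⟩
  have h := hC i j hij
  simp only [InternalNode.C, ClassicalSwing.toLitNode, toModelRel, Cc] at h ⊢
  exact_mod_cast h

/-- **LOCAL EXPONENTIAL STABILITY OF THE SYNCHRONOUS EQUILIBRIUM** of `d.toModelRel λ 0` (lossless record, reciprocal `B`, positive
inertias and couplings, exact acute A1 data, `λ > 0`): lit-2's `InternalNode.syncEquilibrium_locally_expStable` BY NAME with every
hypothesis discharged; solutions are model-1's `IsSolutionOn … univ`, speeds are model-1's deviations (`ω_s` drops out).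
[cite: DorflerChertkovBullo2013, SI §3.1 Lemma 1 (ii), Lemma 2 (2); SauerPai1998, §9.4 eqs. (9.17)–(9.18)] -/
theorem syncEquilibrium_locally_expStable (lam : ℚ) (hlam : 0 < lam) (hM : ∀ i, 0 < d.M i)
    (hG : ∀ i j, i ≠ j → d.G i j = 0) (hB : ∀ i j, d.B i j = d.B j i) (hC : ∀ i j, i ≠ j → 0 < d.Cc i j)
    (hCii : ∀ i, 0 ≤ d.Cc i i) (hE : d.EqData d.angleOf) (harc : ∀ i j, |d.angleOf i - d.angleOf j| < Real.pi / 2) :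
    ∃ ρ > 0, ∃ k > 0, ∃ μ > 0, ∀ c : ℝ → ClassicalSwing.State (n + 1), (d.toModelRel lam 0).IsSolutionOn c univ →
      ‖InternalNode.phase ((c 0).1 - d.angleOf) (c 0).2‖ < ρ →
      ∀ t : ℝ, 0 ≤ t →
        ‖InternalNode.phase (fun i => (c t).1 i - (d.angleOf i
              + (∑ j, ((d.toModelRel lam 0).D j * ((c 0).1 j - d.angleOf j) + (d.toModelRel lam 0).M j * (c 0).2 j)) /
                ∑ j, (d.toModelRel lam 0).D j)) (c t).2‖
          ≤ k * ‖InternalNode.phase (fun i => (c 0).1 i - (d.angleOf i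
              + (∑ j, ((d.toModelRel lam 0).D j * ((c 0).1 j - d.angleOf j) + (d.toModelRel lam 0).M j * (c 0).2 j)) /
                ∑ j, (d.toModelRel lam 0).D j)) (c 0).2‖ * Real.exp (-μ * t) := by
  set p := d.toModelRel lam 0 with hp
  have hlam' : (0 : ℝ) < lam := by exact_mod_cast hlam
  have hM' : ∀ i, 0 < p.toLitNode.M i := fun i => by
    rw [ClassicalSwing.toLitNode_M]; simp only [hp, toModelRel]; exact_mod_cast hM i
  have hD' : ∀ i, 0 < p.toLitNode.D i := fun i => by
    simp only [ClassicalSwing.toLitNode, hp, toModelRel]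
    exact mul_pos hlam' (by exact_mod_cast hM i)
  have hB' : ∀ i j, p.toLitNode.B i j = p.toLitNode.B j i := fun i j => by
    simp only [ClassicalSwing.toLitNode, hp, toModelRel]; exact_mod_cast hB i j
  have hG' : ∀ i j, i ≠ j → p.toLitNode.G i j = 0 := fun i j hij => by
    simp only [ClassicalSwing.toLitNode, hp, toModelRel]; exact_mod_cast hG i j hij
  have hC' : ∀ i j, 0 ≤ p.toLitNode.C i j := fun i j => by
    by_cases hij : i = j
    · subst hij
      have h := hCii i
      simp only [InternalNode.C, ClassicalSwing.toLitNode, hp, toModelRel, Cc] at h ⊢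
      exact_mod_cast h
    · have h := (hC i j hij).le
      simp only [InternalNode.C, ClassicalSwing.toLitNode, hp, toModelRel, Cc] at h ⊢
      exact_mod_cast h
  have hconn := d.couplingConnected_of_pos lam hC
  have hδs : p.toLitNode.IsEquilibrium d.angleOf :=
    (p.toLitNode_isEquilibrium_iff d.angleOf).2 (d.isEquilibrium_toModelRel_zero lam hE)
  have harc' : ∀ i j, i ≠ j → 0 < p.toLitNode.C i j → |d.angleOf i - d.angleOf j| < Real.pi / 2 :=
    fun i j _ _ => harc i j
  obtain ⟨ρ, hρ, k, hk, μ, hμ, H⟩ :=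
    p.toLitNode.syncEquilibrium_locally_expStable hM' hD' hB' hG' hC' hconn hδs harc'
  refine ⟨ρ, hρ, k, hk, μ, hμ, fun c hc h0 t ht => ?_⟩
  have hsol := fun s => p.isSolutionAt_toLitNode hc s
  have hωs : p.toLitNode.ωs = 2 := rfl
  have key := H (fun τ => (c τ).1) (fun τ j => (c τ).2 j + 2) hsol
  simp only [hωs, add_sub_cancel_right, ClassicalSwing.toLitNode_M] at key
  have e0 : (fun i => (c 0).2 i) = (c 0).2 := rfl
  have eD : ∀ j, p.toLitNode.D j = p.D j := fun j => rfl
  simp only [eD] at key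
  have h0' : ‖InternalNode.phase ((fun τ => (c τ).1) 0 - d.angleOf) fun i => (c 0).2 i‖ < ρ := by
    simpa using h0
  have := key h0' t ht
  simpa using this

end RecastData

/-! ### Instances (hypothesis-free) -/

namespace NE39L

/-- **NE39L: the synchronous equilibrium of `NE39L.data.toModelRel λ 0` is locally exponentially stable** for every `λ > 0`
(M′ of ★ #121 / ★ #124 at `λ = 1/10`).  MODELLED: lossless-synthetic variant MV-2L + MV-RD + MV-λ + MV-h12; `ρ, k, μ` existential.
[cite: DorflerChertkovBullo2013, SI §3.1 Lemma 1 (ii), Lemma 2 (2)] -/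
theorem syncEquilibrium_locally_expStable (lam : ℚ) (hlam : 0 < lam) :
    ∃ ρ > 0, ∃ k > 0, ∃ μ > 0, ∀ c : ℝ → ClassicalSwing.State 10, (data.toModelRel lam 0).IsSolutionOn c univ →
      ‖InternalNode.phase ((c 0).1 - data.angleOf) (c 0).2‖ < ρ →
      ∀ t : ℝ, 0 ≤ t →
        ‖InternalNode.phase (fun i => (c t).1 i - (data.angleOf i
              + (∑ j, ((data.toModelRel lam 0).D j * ((c 0).1 j - data.angleOf j) + (data.toModelRel lam 0).M j * (c 0).2 j)) /
                ∑ j, (data.toModelRel lam 0).D j)) (c t).2‖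
          ≤ k * ‖InternalNode.phase (fun i => (c 0).1 i - (data.angleOf i
              + (∑ j, ((data.toModelRel lam 0).D j * ((c 0).1 j - data.angleOf j) + (data.toModelRel lam 0).M j * (c 0).2 j)) /
                ∑ j, (data.toModelRel lam 0).D j)) (c 0).2‖ * Real.exp (-μ * t) :=
  data.syncEquilibrium_locally_expStable lam hlam (by decide +kernel) data_transferConductance_eq_zero data_B_symm data_Cc_pos
    (by decide +kernel) data_eqData abs_angleOf_sub_lt

end NE39L

namespace WSCC9

/-- **WSCC9L: the synchronous equilibrium of `WSCC9.postB_relL.toModelRel λ 0` is locally exponentially stable** for every `λ > 0`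
(the LFF-P1 pilot object, `K^G := 0`).  MODELLED: lossless-synthetic VARIANT of the printed 9-bus (MV-2L + MV-RD + MV-λ + MV-h12); `ρ, k, μ`
existential.  [cite: DorflerChertkovBullo2013, SI §3.1 Lemma 1 (ii), Lemma 2 (2)] -/
theorem postB_relL_syncEquilibrium_locally_expStable (lam : ℚ) (hlam : 0 < lam) :
    ∃ ρ > 0, ∃ k > 0, ∃ μ > 0, ∀ c : ℝ → ClassicalSwing.State 3, (postB_relL.toModelRel lam 0).IsSolutionOn c univ →
      ‖InternalNode.phase ((c 0).1 - postB_relL.angleOf) (c 0).2‖ < ρ →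
      ∀ t : ℝ, 0 ≤ t →
        ‖InternalNode.phase (fun i => (c t).1 i - (postB_relL.angleOf i
              + (∑ j, ((postB_relL.toModelRel lam 0).D j * ((c 0).1 j - postB_relL.angleOf j) +
                  (postB_relL.toModelRel lam 0).M j * (c 0).2 j)) / ∑ j, (postB_relL.toModelRel lam 0).D j)) (c t).2‖
          ≤ k * ‖InternalNode.phase (fun i => (c 0).1 i - (postB_relL.angleOf i
              + (∑ j, ((postB_relL.toModelRel lam 0).D j * ((c 0).1 j - postB_relL.angleOf j) +
                  (postB_relL.toModelRel lam 0).M j * (c 0).2 j)) / ∑ j, (postB_relL.toModelRel lam 0).D j)) (c 0).2‖ *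
            Real.exp (-μ * t) :=
  postB_relL.syncEquilibrium_locally_expStable lam hlam (by decide +kernel) postB_relL_transferConductance_eq_zero postB_relL_B_symm
    postB_relL_Cc_pos (by decide +kernel) postB_relL_eqData postB_relL_abs_angleOf_sub_lt

end WSCC9

end Summit.Ventures.GridStability.Models

end
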